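import Literature.NumberTheory.GaloisCohomology.Howard2004.LevelDecompositionsOfRefineProofs
import Literature.NumberTheory.GaloisCohomology.Howard2004.DVRSettingEngineRedProofs
import Literature.NumberTheory.GaloisCohomology.Howard2004.DVRSelmerATorsionControlProofs
import Literature.NumberTheory.GaloisCohomology.Howard2004.SelmerARepresentativeProofs
import Literature.NumberTheory.GaloisCohomology.Howard2004.SelmerAScalarStabilityProofs
import Literature.NumberTheory.GaloisCohomology.Howard2004.DVRKolyvaginBoundProofs
import Literature.NumberTheory.GaloisCohomology.Howard2004.TransverseCartesianProofs
import HarnessLib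

/-!
# Howard 2004: the typed print leaf C45.1′ `prop141_casselsTate_skewPairing_atLevel` FROM Prop. 1.4.1 IN ITS OWN
# TWO-MODULE FORM on the LEVELS of a full tower (the «tower entry» of a kernel port) — proofs file

Topic `NumberTheory/GaloisCohomology/Howard2004`. THEOREMS ONLY: no definition, no named fact, no instance, no notation,
no `sorry`.  Cell `pub/bsd-print-x9` (seat x10b-p1-w7 g12, brick «C451-TOWER-ENTRY», `--supports stmt-BirchSwinnertonDyer-22642`;
print leaf G87 = Howard Thm. 1.6.1 ↦ (plan g15 r8) the «Flach leaf» C45.1′).  Sequel of the w7 g11 reformulations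
`CasselsTateSkewPairingOfLevelDecompositionsProofs` (C45.1′ ⟺ `HasLevelDecompositionsAt`), `CasselsTateSkewPairingParityFormProofs`
(⟺ even layers) and `LevelDecompositionsOfRefineProofs` (⟺ the same on FULL settings, `e_i = i + 1`).

SOURCE. B. Howard, *The Heegner point Kolyvagin system*, Compositio Math. **140** (2004) = arXiv:1202.6340, §1.4: Prop. 1.4.1
(p0008 L83–98: «For positive integers `s` and `t` with `s + t ≤ k` there is a pairing
`( , )_{s,t} : H¹_𝓕(K, T/𝔪^sT) × H¹_{𝓕*}(K, T*[𝔪^t]) → R` whose kernels on the left and right are the images of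
`H¹_𝓕(K, T/𝔪^{s+t}T) → H¹_𝓕(K, T/𝔪^sT)`, `H¹_{𝓕*}(K, T*[𝔪^{s+t}]) →^{π^s} H¹_{𝓕*}(K, T*[𝔪^t])`») and the proof of Thm. 1.4.2
(p0008 L108–L142: «we may identify `H¹_{𝓕*}(K, T*[𝔪]) ≅ H¹_𝓕(K, T[𝔪]) ≅ ℋ[𝔪]` and `H¹_𝓕(K, T/𝔪^sT) ≅ ℋ[𝔪^s]`» — H.4 and
Lemma 1.3.3 — then displays (i)(ii)).  The typed leaf records (i)(ii) on `ℋ = H¹_{𝓕(n)}(K, T^{(k)})` AFTER these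
identifications; this file performs the identifications IN THE KERNEL, so that a port of Prop. 1.4.1 may work where the
pairing is actually constructed: on the tower LEVELS.

WHAT IS PROVED (on a `DVRSetting` `S` with H.0–H.5; `N_j = T^{(j)}`, `𝓗_j(n) = H¹_{𝓕(n)}(K, N_j)`, `H¹(r•) = scalarMapH1`).
* §1 **`DVRSetting.redLEH1_succ`**, **`DVRSetting.incH1LE_redLEH1`** — the tower read-through identity
  `H¹(inc_{i→j}) (H¹(red_{j→i}) c) = H¹(π^{e_j - e_i} •) c` on `H¹(K, N_j)` (`i ≤ j`; iterate of `AdicTower.incH1_redH1`),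
  and **`DVRSetting.mem_selmerGroup_atLevel_and_pow_eq_zero_iff_exists_incH1LE`** — Lemma 1.3.3 at level `n` as an `iff`
  through several levels: `x ∈ 𝓗_j(n) ∧ π^{e_i} x = 0 ↔ x = H¹(inc_{i→j}) a`, `a ∈ 𝓗_i(n)` (`n ∈ 𝓝^{(m)}`, `j ≤ m`).
* §2 **`DVRSetting.skewPairings_display_of_towerSkewPairing`** — on a FULL setting (`e_i = i + 1`, so `N_j = T/𝔪^{j+1}T`,
  `N_0 = T̄`), at a level `k`, `n ∈ 𝓝^{(k)}`, `t + 1 < e_k`: a bi-additive pairing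
  `P₂ : 𝓗_t(n) × 𝓗_0(n) → R/𝔪`, `R`-equivariant in both slots, with LEFT kernel `= H¹(red)(𝓗_{t+1}(n))`, RIGHT kernel
  `= H¹(red^{t+1})(𝓗_{t+1}(n))` and `P₂(a, H¹(red^t) b) = -P₂(b, H¹(red^t) a)` — Prop. 1.4.1 at `(s, t) = (t+1, 1)` in its
  own two-module form, `T*`-side carried to the `T`-side (as print does by H.4) — YIELDS THE FIVE CLAUSES OF THE TYPED
  LEAF at `(k, n, t)`, VERBATIM, through the identifications `𝓗_t(n) ≅ 𝓗_k(n)[π^{t+1}]`, `𝓗_0(n) ≅ 𝓗_k(n)[π]`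
  (`H¹(inc)`, Lemma 1.3.3 at level `n`: `TransverseCartesianProofs`) and §1 (`H¹(inc) ∘ H¹(red^d) = π^d`).
* **`DVRSetting.hasLevelDecompositionsAt_of_towerSkewPairings`** — the per-setting form (one FULL setting, all `(k, n, t)`)
  ⟹ `S.HasLevelDecompositionsAt hy` (the slot the G87 engine `thm161_printIntended_of_h159_hcheb` reads per full setting).
* §3 **`prop141_casselsTate_skewPairing_atLevel_of_forall_full_towerSkewPairings`** — if every FULL `DVRSetting` with
  H.0–H.5 carries such two-module pairings at every `(k, n, t)`, the typed leaf C45.1′ holds (§2 ∘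
  `hasLevelDecompositionsAt_of_skewPairings_display` ∘ `prop141_casselsTate_skewPairing_atLevel_of_forall_full_hasLevelDecompositionsAt`).

READING (numbers, for the desk).  This is the statement a kernel port of Prop. 1.4.1 / Flach must deliver, in the currency
where the cup product lives: for the exact sequence of LEVELS `0 → N_0 →(inc^{t+1}) N_{t+1} →(red) N_t → 0` with the
conditions `𝓕(n)` (exact in the sense of Morgan–Smith arXiv:2103.08530 Thm. 1.3 by H.3 / `comap_incLoc_atLevel_cond_eq` /
`cond_red`), a pairing `Sel(N_t) × Sel(N_0^∨) → ℚ/ℤ` with left kernel `red(Sel N_{t+1})` and right kernel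
`(inc^{t+1})^∨(Sel N_{t+1}^∨)`, transported to the `T`-side by H.4 (`N_j^∨ ≅ Tw(N_j)`, `(inc^{t+1})^∨ = red^{t+1}`), with the
skew identity of display (ii) / MS Thm. 3.7.  Nothing of that construction is done here.

HONEST FRAMING: the two-module pairing is a HYPOTHESIS of §2–§3; Flach's pairing is not constructed; Prop. 1.4.1, Thm. 1.4.2,
C45.1′ and `thm161_dvrKolyvaginBound` are NOT proved; no summit statement is proved; the Birch–Swinnerton-Dyer conjecture
is not proved by any of this.
-/

set_option autoImplicit false

noncomputable section

namespace Literature.NumberTheory.GaloisCohomology.Howard2004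

open Function NumberField IsDedekindDomain Field
open scoped NumberField ContRepresentation Pointwise
open Literature.NumberTheory.GaloisRepresentations
open Literature.NumberTheory.GaloisRepresentations.DiscreteGaloisModule

namespace DVRSetting

variable {p : ℕ} [Fact p.Prime] {K : Type} [Field K] [NumberField K]
  {R : Type} [CommRing R] [IsDomain R] [IsDiscreteValuationRing R] [Algebra ℤ_[p] R]
  {N : ℕ → Type} [∀ k, AddCommGroup (N k)] [∀ k, TopologicalSpace (N k)]
  [∀ k, DiscreteTopology (N k)] [∀ k, Module R (N k)]
  {Rk : ℕ → Type} [∀ k, CommRing (Rk k)] [∀ k, IsLocalRing (Rk k)] [∀ k, TopologicalSpace (Rk k)]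
  [∀ k, DiscreteTopology (Rk k)] [∀ k, Algebra ℤ_[p] (Rk k)] [∀ k, Algebra R (Rk k)]
  [∀ k, Module (Rk k) (N k)] [∀ k, IsScalarTower R (Rk k) (N k)]
  {Nbar : Type} [AddCommGroup Nbar] [TopologicalSpace Nbar] [DiscreteTopology Nbar]
  [∀ k, Module (Rk k) Nbar]
  {Nq : ℕ → Finset (HeightOneSpectrum (𝓞 K)) → Type} [∀ k n, AddCommGroup (Nq k n)]
  [∀ k n, TopologicalSpace (Nq k n)] [∀ k n, DiscreteTopology (Nq k n)]
  [∀ k n, Module (Rk k) (Nq k n)] [∀ k n, Module R (Nq k n)]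
  [∀ k n, IsScalarTower R (Rk k) (Nq k n)]

/-! ## §1 The tower read-through identity `H¹(inc_{i→j}) ∘ H¹(red_{j→i}) = H¹(π^{e_j-e_i} •)` and Lemma 1.3.3 as an `iff` -/

/-- `H¹(red_{j+1→i}) = H¹(red_{j→i}) ∘ H¹(red_j)` (`redLE (i ≤ j+1) = redLE (i ≤ j) ∘ red_j`, `AdicTower.redLE_succ`).
[cite: Howard2004HeegnerKolyvagin, §1.6 (arXiv:1202.6340 p. 11 L33–38, p. 12 L29–33)] -/
theorem redLEH1_succ (S : DVRSetting p K R N Rk Nbar Nq) {i j : ℕ} (h : i ≤ j)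
    (c : galoisCohomology (S.T.ρ (j + 1)) 1) :
    S.redLEH1 (Nat.le_succ_of_le h) c = S.redLEH1 h (S.T.redH1 j c) :=
  (cohomologyMap_one_comp_eq (S.T.ρ (j + 1)) (S.T.ρ j) (S.T.ρ i) (S.T.red j).toAddMonoidHom
    (S.T.red_equivariant j) (S.T.redLE h).toAddMonoidHom (fun _ x => S.T.redLE_equivariant h _ x)
    (S.T.redLE (Nat.le_succ_of_le h)).toAddMonoidHom (fun _ x => S.T.redLE_equivariant (Nat.le_succ_of_le h) _ x)
    (fun x => (S.T.redLE_succ h x).symm) c).symm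

/-- **The tower read-through identity** `H¹(inc_{i→j}) (H¹(red_{j→i}) c) = H¹(π^{e_j - e_i} •) c` on `H¹(K, T^{(j)})`
(`i ≤ j`): the cohomology of `inc ∘ red = π^{e_{k+1}-e_k}` (`AdicTower.incH1_redH1`), iterated — «the reduction
`T/𝔪^{s+t}T → T/𝔪^sT` read inside `ℋ` is multiplication by `π^t`», the identification behind «`H¹_𝓕(K, T/𝔪^sT) ≅ ℋ[𝔪^s]`».
[cite: Howard2004HeegnerKolyvagin, Lemma 1.3.3 and the proof of Thm. 1.4.2 (arXiv:1202.6340 p. 7 L152–160, p0008 L116–L120), §1.6 (p. 12 L40–48)] -/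
theorem incH1LE_redLEH1 (S : DVRSetting p K R N Rk Nbar Nq) (hy : S.SatisfiesH)
    (hπm : S.π ∈ IsLocalRing.maximalIdeal R) (hle : ∀ k, S.e k ≤ S.e (k + 1)) (i : ℕ) :
    ∀ (j : ℕ) (h : i ≤ j) (c : galoisCohomology (S.T.ρ j) 1),
      AdicTower.incH1LE S.T S.π S.e hy.killed hy.ker_red hπm hle i j h (S.redLEH1 h c) =
        galoisCohomology.scalarMapH1 (S.T.ρ j) (S.T.hlin j) (S.π ^ (S.e j - S.e i)) c := by
  intro j h
  induction h with
  | refl =>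
    intro c
    have h0 : AdicTower.incH1LE S.T S.π S.e hy.killed hy.ker_red hπm hle i i le_rfl = AddMonoidHom.id _ :=
      Nat.leRec_self _ _
    rw [h0, AddMonoidHom.id_apply, S.redLEH1_self, Nat.sub_self, pow_zero, galoisCohomology.scalarMapH1_one,
      AddMonoidHom.id_apply]
  | @step j hij ih =>
    intro c
    have h1 : AdicTower.incH1LE S.T S.π S.e hy.killed hy.ker_red hπm hle i (j + 1) (Nat.le.step hij) =
        (S.T.incH1 S.π S.e hy.killed hy.ker_red hπm hle j).comp
          (AdicTower.incH1LE S.T S.π S.e hy.killed hy.ker_red hπm hle i j hij) :=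
      Nat.leRec_succ _ _ hij
    have hexp : S.e (j + 1) - S.e j + (S.e j - S.e i) = S.e (j + 1) - S.e i := by
      have h2 : S.e i ≤ S.e j := hy.e_strictMono.monotone hij
      have h3 : S.e j ≤ S.e (j + 1) := hle j
      omega
    rw [h1, AddMonoidHom.comp_apply, S.redLEH1_succ hij c, ih (S.T.redH1 j c), ← AdicTower.redH1_scalarMapH1,
      AdicTower.incH1_redH1, ← AddMonoidHom.comp_apply, ← galoisCohomology.scalarMapH1_mul, ← pow_add, hexp]

/-- **Lemma 1.3.3 at level `n` through several levels, as an `iff`**: for `i ≤ j ≤ m` and `n` with `Γ_L` acting trivially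
on the levels `≤ m` at the primes of `n` (`n ∈ 𝓝^{(m)}`), a class `x ∈ H¹(K, T^{(j)})` is an `𝓕(n)`-Selmer class killed by
`π^{e_i}` iff `x = H¹(inc_{i→j}) a` for an `𝓕(n)`-Selmer class `a ∈ H¹_{𝓕(n)}(K, T^{(i)})` — «`H¹_𝓕(K, T/𝔪^sT) ≅ ℋ[𝔪^s]`»
(`exists_mem_selmerGroup_atLevel_incH1LE_eq` + `incH1LE_mem_selmerGroup_atLevel_iff` + `𝔪^{e_i} T^{(i)} = 0`).
[cite: Howard2004HeegnerKolyvagin, Lemma 1.3.3 with Lemma 1.5.1, proof of Thm. 1.4.2 (arXiv:1202.6340 p. 7 L152–160, p. 9 L127–133, p0008 L116–L120)]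
[cite: MazurRubinMemoirs2004, Lemma 3.5.4] -/
theorem mem_selmerGroup_atLevel_and_pow_eq_zero_iff_exists_incH1LE (S : DVRSetting p K R N Rk Nbar Nq)
    (hy : S.SatisfiesH) (hπm : S.π ∈ IsLocalRing.maximalIdeal R) (hle : ∀ k, S.e k ≤ S.e (k + 1))
    (n : Finset (HeightOneSpectrum (𝓞 K))) (m : ℕ)
    (htriv : ∀ j, j ≤ m → ∀ w ∈ n, ∀ g ∈ transverseFixer p (residueChar w) S.jbar w, ∀ y : N j,
      GaloisRep.toLocal w (S.T.ρ j) g y = y)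
    {i j : ℕ} (h : i ≤ j) (hjm : j ≤ m) (x : galoisCohomology (S.T.ρ j) 1) :
    (x ∈ (((S.t j).atLevel S.jbar n).cond).selmerGroup ∧
        galoisCohomology.scalarMapH1 (S.T.ρ j) (S.T.hlin j) (S.π ^ S.e i) x = 0) ↔
      ∃ a ∈ (((S.t i).atLevel S.jbar n).cond).selmerGroup,
        AdicTower.incH1LE S.T S.π S.e hy.killed hy.ker_red hπm hle i j h a = x := by
  obtain ⟨d, rfl⟩ := Nat.exists_eq_add_of_le h
  constructor
  · rintro ⟨hx, h0⟩
    exact S.exists_mem_selmerGroup_atLevel_incH1LE_eq hy hπm hle n m htriv i d hjm x hx h0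
  · rintro ⟨a, ha, rfl⟩
    refine ⟨(S.incH1LE_mem_selmerGroup_atLevel_iff hy hπm hle n m htriv i d hjm a).2 ha, ?_⟩
    have hk : galoisCohomology.scalarMapH1 (S.T.ρ i) (S.T.hlin i) (S.π ^ S.e i) a = 0 :=
      galoisCohomology.smul_eq_zero_of_forall (S.T.ρ i) (S.T.hlin i) _
        (fun y => hy.killed i _ (Ideal.pow_mem_pow hπm _) y) a
    have hc := DFunLike.congr_fun (AdicTower.scalarMapH1_comp_incH1LE S.T S.π S.e hy.killed hy.ker_red hπm hle
      (S.π ^ S.e i) i (i + d) (Nat.le_add_right i d)) a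
    rw [AddMonoidHom.comp_apply, AddMonoidHom.comp_apply, hk, map_zero] at hc
    exact hc

/-! ## §2 The five clauses of the leaf from Prop. 1.4.1 in two-module form on a full tower -/

/-- **THE LEAF'S DISPLAY FROM PROP. 1.4.1 IN ITS OWN TWO-MODULE FORM (tower entry).**  On a FULL `DVRSetting` (`e_i = i + 1`:
`N_j = T/𝔪^{j+1}T`, `N_0 = T̄`) with H.0–H.5, fix a level `k`, `n ∈ 𝓝^{(k)}` and `t + 1 < e_k`, and write
`𝓗_j(n) = H¹_{𝓕(n)}(K, N_j)`.  Suppose given a bi-additive pairing `P₂ : 𝓗_t(n) × 𝓗_0(n) → R/𝔪`, `R`-equivariant in both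
slots, whose LEFT kernel is exactly `H¹(red_{t+1→t})(𝓗_{t+1}(n))`, whose RIGHT kernel is exactly
`H¹(red_{t+1→0})(𝓗_{t+1}(n))`, and with `P₂(a, H¹(red_{t→0}) b) = -P₂(b, H¹(red_{t→0}) a)` — Prop. 1.4.1 at
`(s, t) = (t+1, 1)` («kernels … are the images of `H¹_𝓕(K,T/𝔪^{s+1}T) → H¹_𝓕(K,T/𝔪^sT)` and of `π^s`») with display (ii),
the `T*`-side read on the `T`-side as print does by H.4.  THEN the five clauses of the typed leaf
`prop141_casselsTate_skewPairing_atLevel` hold at `(k, n, t)`, VERBATIM, for the transported pairing on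
`𝓗_k(n)[π^{t+1}] × 𝓗_k(n)[π]`: the identifications «`H¹_𝓕(K, T/𝔪^sT) ≅ ℋ[𝔪^s]`», «`H¹_𝓕(K, T[𝔪]) ≅ ℋ[𝔪]`» are
`H¹(inc_{t→k})`, `H¹(inc_{0→k})` (Lemma 1.3.3 at level `n`, §1), under which `H¹(red^d)` reads `π^d` (§1 `incH1LE_redLEH1`).
[cite: Howard2004HeegnerKolyvagin, Prop. 1.4.1 and Thm. 1.4.2 (proof: identifications and displays (i)(ii)) (arXiv:1202.6340 p0008 L83–L142), Lemma 1.3.3 (p. 7 L152–160), §1.6 ¶1 (p0011 L33–44)]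
[cite: Flach1990, the generalised Cassels–Tate pairing and its kernels] -/
theorem skewPairings_display_of_towerSkewPairing (S : DVRSetting p K R N Rk Nbar Nq) (hy : S.SatisfiesH)
    (hfull : ∀ i, S.e i = i + 1) (k : ℕ) (n : Finset (HeightOneSpectrum (𝓞 K)))
    (hn : ↑n ⊆ S.levelPrimes k) (t : ℕ) (ht : t + 1 < S.e k)
    (P₂ : ↥(((S.t t).atLevel S.jbar n).cond).selmerGroup →+
      ↥(((S.t 0).atLevel S.jbar n).cond).selmerGroup →+ (R ⧸ IsLocalRing.maximalIdeal R))
    (hP₁ : ∀ (r : R) (a a' : ↥(((S.t t).atLevel S.jbar n).cond).selmerGroup)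
        (w : ↥(((S.t 0).atLevel S.jbar n).cond).selmerGroup),
      (a' : galoisCohomology (S.T.ρ t) 1) =
        galoisCohomology.scalarMapH1 (S.T.ρ t) (S.T.hlin t) r (a : galoisCohomology (S.T.ρ t) 1) →
      P₂ a' w = r • P₂ a w)
    (hP₂ : ∀ (r : R) (a : ↥(((S.t t).atLevel S.jbar n).cond).selmerGroup)
        (w w' : ↥(((S.t 0).atLevel S.jbar n).cond).selmerGroup),
      (w' : galoisCohomology (S.T.ρ 0) 1) =
        galoisCohomology.scalarMapH1 (S.T.ρ 0) (S.T.hlin 0) r (w : galoisCohomology (S.T.ρ 0) 1) →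
      P₂ a w' = r • P₂ a w)
    (hleft : ∀ a : ↥(((S.t t).atLevel S.jbar n).cond).selmerGroup,
      (∀ w, P₂ a w = 0) ↔ ∃ z ∈ (((S.t (t + 1)).atLevel S.jbar n).cond).selmerGroup,
        (a : galoisCohomology (S.T.ρ t) 1) = S.redLEH1 (Nat.le_succ t) z)
    (hright : ∀ w : ↥(((S.t 0).atLevel S.jbar n).cond).selmerGroup,
      (∀ a, P₂ a w = 0) ↔ ∃ z ∈ (((S.t (t + 1)).atLevel S.jbar n).cond).selmerGroup,
        (w : galoisCohomology (S.T.ρ 0) 1) = S.redLEH1 (Nat.zero_le (t + 1)) z)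
    (hskew : ∀ (a b : ↥(((S.t t).atLevel S.jbar n).cond).selmerGroup)
        (a₀ b₀ : ↥(((S.t 0).atLevel S.jbar n).cond).selmerGroup),
      (a₀ : galoisCohomology (S.T.ρ 0) 1) = S.redLEH1 (Nat.zero_le t) (a : galoisCohomology (S.T.ρ t) 1) →
      (b₀ : galoisCohomology (S.T.ρ 0) 1) = S.redLEH1 (Nat.zero_le t) (b : galoisCohomology (S.T.ρ t) 1) →
      P₂ a b₀ = - P₂ b a₀) :
    ∃ P : ↥((((S.t k).atLevel S.jbar n).cond).selmerGroup ⊓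
        (galoisCohomology.scalarMapH1 (S.T.ρ k) (S.T.hlin k) (S.π ^ (t + 1))).ker) →+
      ↥((((S.t k).atLevel S.jbar n).cond).selmerGroup ⊓
        (galoisCohomology.scalarMapH1 (S.T.ρ k) (S.T.hlin k) S.π).ker) →+ (R ⧸ IsLocalRing.maximalIdeal R),
      (∀ (r : R) (x x' : ↥((((S.t k).atLevel S.jbar n).cond).selmerGroup ⊓
          (galoisCohomology.scalarMapH1 (S.T.ρ k) (S.T.hlin k) (S.π ^ (t + 1))).ker))
          (w : ↥((((S.t k).atLevel S.jbar n).cond).selmerGroup ⊓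
            (galoisCohomology.scalarMapH1 (S.T.ρ k) (S.T.hlin k) S.π).ker)),
        (x' : galoisCohomology (S.T.ρ k) 1) =
          galoisCohomology.scalarMapH1 (S.T.ρ k) (S.T.hlin k) r (x : galoisCohomology (S.T.ρ k) 1) →
        P x' w = r • P x w) ∧
      (∀ (r : R) (x : ↥((((S.t k).atLevel S.jbar n).cond).selmerGroup ⊓
          (galoisCohomology.scalarMapH1 (S.T.ρ k) (S.T.hlin k) (S.π ^ (t + 1))).ker))
          (w w' : ↥((((S.t k).atLevel S.jbar n).cond).selmerGroup ⊓
            (galoisCohomology.scalarMapH1 (S.T.ρ k) (S.T.hlin k) S.π).ker)),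
        (w' : galoisCohomology (S.T.ρ k) 1) =
          galoisCohomology.scalarMapH1 (S.T.ρ k) (S.T.hlin k) r (w : galoisCohomology (S.T.ρ k) 1) →
        P x w' = r • P x w) ∧
      (∀ x : ↥((((S.t k).atLevel S.jbar n).cond).selmerGroup ⊓
          (galoisCohomology.scalarMapH1 (S.T.ρ k) (S.T.hlin k) (S.π ^ (t + 1))).ker),
        (∀ w, P x w = 0) ↔
          ∃ z ∈ (((S.t k).atLevel S.jbar n).cond).selmerGroup,
            galoisCohomology.scalarMapH1 (S.T.ρ k) (S.T.hlin k) (S.π ^ (t + 2)) z = 0 ∧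
            (x : galoisCohomology (S.T.ρ k) 1) = galoisCohomology.scalarMapH1 (S.T.ρ k) (S.T.hlin k) S.π z) ∧
      (∀ w : ↥((((S.t k).atLevel S.jbar n).cond).selmerGroup ⊓
          (galoisCohomology.scalarMapH1 (S.T.ρ k) (S.T.hlin k) S.π).ker),
        (∀ x, P x w = 0) ↔
          ∃ z ∈ (((S.t k).atLevel S.jbar n).cond).selmerGroup,
            galoisCohomology.scalarMapH1 (S.T.ρ k) (S.T.hlin k) (S.π ^ (t + 2)) z = 0 ∧
            (w : galoisCohomology (S.T.ρ k) 1) =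
              galoisCohomology.scalarMapH1 (S.T.ρ k) (S.T.hlin k) (S.π ^ (t + 1)) z) ∧
      (∀ (a b : ↥((((S.t k).atLevel S.jbar n).cond).selmerGroup ⊓
          (galoisCohomology.scalarMapH1 (S.T.ρ k) (S.T.hlin k) (S.π ^ (t + 1))).ker))
          (a' b' : ↥((((S.t k).atLevel S.jbar n).cond).selmerGroup ⊓
            (galoisCohomology.scalarMapH1 (S.T.ρ k) (S.T.hlin k) S.π).ker)),
        (a' : galoisCohomology (S.T.ρ k) 1) =
          galoisCohomology.scalarMapH1 (S.T.ρ k) (S.T.hlin k) (S.π ^ t) (a : galoisCohomology (S.T.ρ k) 1) →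
        (b' : galoisCohomology (S.T.ρ k) 1) =
          galoisCohomology.scalarMapH1 (S.T.ρ k) (S.T.hlin k) (S.π ^ t) (b : galoisCohomology (S.T.ρ k) 1) →
        P a b' = - P b a') := by
  classical
  -- tower bookkeeping (`N_j = T^{(j)}`, `e_j = j + 1`)
  have hπm : S.π ∈ IsLocalRing.maximalIdeal R := by rw [hy.unif]; exact Ideal.mem_span_singleton_self _
  have hle : ∀ j, S.e j ≤ S.e (j + 1) := fun j => hy.e_strictMono.monotone (Nat.le_succ j)
  have htriv := S.htriv_of_subset_levelPrimes hy hn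
  have het : S.e t = t + 1 := hfull t
  have he0 : S.e 0 = 1 := by rw [hfull]
  have hes : S.e (t + 1) = t + 2 := hfull (t + 1)
  have htk : t + 1 ≤ k := by rw [hfull k] at ht; omega
  have htk' : t ≤ k := by omega
  -- the transitions `ι_t = H¹(inc_{t→k})`, `ι_0 = H¹(inc_{0→k})`, `ι_{t+1} = H¹(inc_{t+1→k})`: injective, `R`-linear
  have hιt_inj : Function.Injective (AdicTower.incH1LE S.T S.π S.e hy.killed hy.ker_red hπm hle t k htk') :=
    S.incH1LE_injective hy hπm hle t k htk'
  have hι0_inj : Function.Injective (AdicTower.incH1LE S.T S.π S.e hy.killed hy.ker_red hπm hle 0 k (Nat.zero_le k)) :=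
    S.incH1LE_injective hy hπm hle 0 k (Nat.zero_le k)
  have hι_sm : ∀ (i : ℕ) (hi : i ≤ k) (r : R) (a : galoisCohomology (S.T.ρ i) 1),
      AdicTower.incH1LE S.T S.π S.e hy.killed hy.ker_red hπm hle i k hi
          (galoisCohomology.scalarMapH1 (S.T.ρ i) (S.T.hlin i) r a) =
        galoisCohomology.scalarMapH1 (S.T.ρ k) (S.T.hlin k) r
          (AdicTower.incH1LE S.T S.π S.e hy.killed hy.ker_red hπm hle i k hi a) := fun i hi r a => by
    have hc := DFunLike.congr_fun
      (AdicTower.scalarMapH1_comp_incH1LE S.T S.π S.e hy.killed hy.ker_red hπm hle r i k hi) a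
    rw [AddMonoidHom.comp_apply, AddMonoidHom.comp_apply] at hc
    exact hc.symm
  -- §1 read through the transitions: `ι_t ∘ H¹(red_{t+1→t}) = π ∘ ι_{t+1}`,
  -- `ι_0 ∘ H¹(red_{t+1→0}) = π^{t+1} ∘ ι_{t+1}`, `ι_0 ∘ H¹(red_{t→0}) = π^t ∘ ι_t`
  have hred1 : ∀ z : galoisCohomology (S.T.ρ (t + 1)) 1,
      AdicTower.incH1LE S.T S.π S.e hy.killed hy.ker_red hπm hle t k htk' (S.redLEH1 (Nat.le_succ t) z) =
        galoisCohomology.scalarMapH1 (S.T.ρ k) (S.T.hlin k) S.π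
          (AdicTower.incH1LE S.T S.π S.e hy.killed hy.ker_red hπm hle (t + 1) k htk z) := by
    intro z
    have h1 := S.incH1LE_redLEH1 hy hπm hle t (t + 1) (Nat.le_succ t) z
    have hx : S.e (t + 1) - S.e t = 1 := by rw [hes, het]; omega
    rw [hx, pow_one] at h1
    rw [← AdicTower.incH1LE_incH1LE S.T S.π S.e hy.killed hy.ker_red hπm hle t (t + 1) (Nat.le_succ t) k htk,
      h1, hι_sm (t + 1) htk]
  have hred2 : ∀ z : galoisCohomology (S.T.ρ (t + 1)) 1,
      AdicTower.incH1LE S.T S.π S.e hy.killed hy.ker_red hπm hle 0 k (Nat.zero_le k) (S.redLEH1 (Nat.zero_le (t + 1)) z) =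
        galoisCohomology.scalarMapH1 (S.T.ρ k) (S.T.hlin k) (S.π ^ (t + 1))
          (AdicTower.incH1LE S.T S.π S.e hy.killed hy.ker_red hπm hle (t + 1) k htk z) := by
    intro z
    have h1 := S.incH1LE_redLEH1 hy hπm hle 0 (t + 1) (Nat.zero_le (t + 1)) z
    have hx : S.e (t + 1) - S.e 0 = t + 1 := by rw [hes, he0]; omega
    rw [hx] at h1
    rw [← AdicTower.incH1LE_incH1LE S.T S.π S.e hy.killed hy.ker_red hπm hle 0 (t + 1) (Nat.zero_le (t + 1)) k
      htk, h1, hι_sm (t + 1) htk]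
  have hred3 : ∀ a : galoisCohomology (S.T.ρ t) 1,
      AdicTower.incH1LE S.T S.π S.e hy.killed hy.ker_red hπm hle 0 k (Nat.zero_le k) (S.redLEH1 (Nat.zero_le t) a) =
        galoisCohomology.scalarMapH1 (S.T.ρ k) (S.T.hlin k) (S.π ^ t)
          (AdicTower.incH1LE S.T S.π S.e hy.killed hy.ker_red hπm hle t k htk' a) := by
    intro a
    have h1 := S.incH1LE_redLEH1 hy hπm hle 0 t (Nat.zero_le t) a
    have hx : S.e t - S.e 0 = t := by rw [het, he0]; omega
    rw [hx] at h1
    rw [← AdicTower.incH1LE_incH1LE S.T S.π S.e hy.killed hy.ker_red hπm hle 0 t (Nat.zero_le t) k htk', h1,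
      hι_sm t htk']
  -- Lemma 1.3.3 at level `n`: `𝓗_k(n)[π^{t+1}] = ι_t(𝓗_t(n))`, `𝓗_k(n)[π] = ι_0(𝓗_0(n))`, `𝓗_k(n)[π^{t+2}] = ι_{t+1}(𝓗_{t+1}(n))`
  have hAt : ∀ x : galoisCohomology (S.T.ρ k) 1,
      x ∈ ((((S.t k).atLevel S.jbar n).cond).selmerGroup ⊓
        (galoisCohomology.scalarMapH1 (S.T.ρ k) (S.T.hlin k) (S.π ^ (t + 1))).ker) ↔
        ∃ a ∈ (((S.t t).atLevel S.jbar n).cond).selmerGroup,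
          AdicTower.incH1LE S.T S.π S.e hy.killed hy.ker_red hπm hle t k htk' a = x := by
    intro x
    have h := S.mem_selmerGroup_atLevel_and_pow_eq_zero_iff_exists_incH1LE hy hπm hle n k htriv htk' le_rfl x
    rw [het] at h
    rw [AddSubgroup.mem_inf, AddMonoidHom.mem_ker]
    exact h
  have hA0 : ∀ x : galoisCohomology (S.T.ρ k) 1,
      x ∈ ((((S.t k).atLevel S.jbar n).cond).selmerGroup ⊓ (galoisCohomology.scalarMapH1 (S.T.ρ k) (S.T.hlin k) S.π).ker) ↔
        ∃ a ∈ (((S.t 0).atLevel S.jbar n).cond).selmerGroup,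
          AdicTower.incH1LE S.T S.π S.e hy.killed hy.ker_red hπm hle 0 k (Nat.zero_le k) a = x := by
    intro x
    have h := S.mem_selmerGroup_atLevel_and_pow_eq_zero_iff_exists_incH1LE hy hπm hle n k htriv (Nat.zero_le k)
      le_rfl x
    rw [he0, pow_one] at h
    rw [AddSubgroup.mem_inf, AddMonoidHom.mem_ker]
    exact h
  have hAs : ∀ x : galoisCohomology (S.T.ρ k) 1,
      (x ∈ (((S.t k).atLevel S.jbar n).cond).selmerGroup ∧
          galoisCohomology.scalarMapH1 (S.T.ρ k) (S.T.hlin k) (S.π ^ (t + 2)) x = 0) ↔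
        ∃ a ∈ (((S.t (t + 1)).atLevel S.jbar n).cond).selmerGroup,
          AdicTower.incH1LE S.T S.π S.e hy.killed hy.ker_red hπm hle (t + 1) k htk a = x := by
    intro x
    have h := S.mem_selmerGroup_atLevel_and_pow_eq_zero_iff_exists_incH1LE hy hπm hle n k htriv htk le_rfl x
    rw [hes] at h
    exact h
  -- the identifications `e_t : 𝓗_t(n) ≃ 𝓗_k(n)[π^{t+1}]`, `e_0 : 𝓗_0(n) ≃ 𝓗_k(n)[π]`
  let φt : ↥(((S.t t).atLevel S.jbar n).cond).selmerGroup →+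
      ↥((((S.t k).atLevel S.jbar n).cond).selmerGroup ⊓
        (galoisCohomology.scalarMapH1 (S.T.ρ k) (S.T.hlin k) (S.π ^ (t + 1))).ker) :=
    AddMonoidHom.mk' (fun a => ⟨AdicTower.incH1LE S.T S.π S.e hy.killed hy.ker_red hπm hle t k htk' a.1,
        (hAt _).2 ⟨a.1, a.2, rfl⟩⟩)
      (fun a b => Subtype.ext (map_add (AdicTower.incH1LE S.T S.π S.e hy.killed hy.ker_red hπm hle t k htk') a.1 b.1))
  have hφt : ∀ a, (φt a).1 = AdicTower.incH1LE S.T S.π S.e hy.killed hy.ker_red hπm hle t k htk' a.1 :=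
    fun _ => rfl
  have hφt_bij : Function.Bijective φt := by
    refine ⟨fun a b hab => Subtype.ext (hιt_inj ?_), fun x => ?_⟩
    · have := congrArg Subtype.val hab
      rwa [hφt, hφt] at this
    · obtain ⟨a, ha, hax⟩ := (hAt x.1).1 x.2
      exact ⟨⟨a, ha⟩, Subtype.ext ((hφt _).trans hax)⟩
  let et : ↥(((S.t t).atLevel S.jbar n).cond).selmerGroup ≃+
      ↥((((S.t k).atLevel S.jbar n).cond).selmerGroup ⊓
        (galoisCohomology.scalarMapH1 (S.T.ρ k) (S.T.hlin k) (S.π ^ (t + 1))).ker) :=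
    AddEquiv.ofBijective φt hφt_bij
  have het_symm : ∀ x : ↥((((S.t k).atLevel S.jbar n).cond).selmerGroup ⊓
        (galoisCohomology.scalarMapH1 (S.T.ρ k) (S.T.hlin k) (S.π ^ (t + 1))).ker),
      AdicTower.incH1LE S.T S.π S.e hy.killed hy.ker_red hπm hle t k htk'
          ((et.symm x : ↥(((S.t t).atLevel S.jbar n).cond).selmerGroup) : galoisCohomology (S.T.ρ t) 1) =
        (x : galoisCohomology (S.T.ρ k) 1) := by
    intro x
    have h1 : ((et (et.symm x) : ↥((((S.t k).atLevel S.jbar n).cond).selmerGroup ⊓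
        (galoisCohomology.scalarMapH1 (S.T.ρ k) (S.T.hlin k) (S.π ^ (t + 1))).ker)) :
        galoisCohomology (S.T.ρ k) 1) = (x : galoisCohomology (S.T.ρ k) 1) := by rw [AddEquiv.apply_symm_apply]
    exact (hφt (et.symm x)).symm.trans h1
  let φ0 : ↥(((S.t 0).atLevel S.jbar n).cond).selmerGroup →+ ↥((((S.t k).atLevel S.jbar n).cond).selmerGroup ⊓ (galoisCohomology.scalarMapH1 (S.T.ρ k) (S.T.hlin k) S.π).ker) :=
    AddMonoidHom.mk' (fun a => ⟨AdicTower.incH1LE S.T S.π S.e hy.killed hy.ker_red hπm hle 0 k (Nat.zero_le k) a.1,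
        (hA0 _).2 ⟨a.1, a.2, rfl⟩⟩)
      (fun a b => Subtype.ext (map_add (AdicTower.incH1LE S.T S.π S.e hy.killed hy.ker_red hπm hle 0 k (Nat.zero_le k)) a.1 b.1))
  have hφ0 : ∀ a, (φ0 a).1 = AdicTower.incH1LE S.T S.π S.e hy.killed hy.ker_red hπm hle 0 k (Nat.zero_le k) a.1 :=
    fun _ => rfl
  have hφ0_bij : Function.Bijective φ0 := by
    refine ⟨fun a b hab => Subtype.ext (hι0_inj ?_), fun x => ?_⟩
    · have := congrArg Subtype.val hab
      rwa [hφ0, hφ0] at this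
    · obtain ⟨a, ha, hax⟩ := (hA0 x.1).1 x.2
      exact ⟨⟨a, ha⟩, Subtype.ext ((hφ0 _).trans hax)⟩
  let e0 : ↥(((S.t 0).atLevel S.jbar n).cond).selmerGroup ≃+ ↥((((S.t k).atLevel S.jbar n).cond).selmerGroup ⊓ (galoisCohomology.scalarMapH1 (S.T.ρ k) (S.T.hlin k) S.π).ker) :=
    AddEquiv.ofBijective φ0 hφ0_bij
  have he0_symm : ∀ x : ↥((((S.t k).atLevel S.jbar n).cond).selmerGroup ⊓ (galoisCohomology.scalarMapH1 (S.T.ρ k) (S.T.hlin k) S.π).ker),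
      AdicTower.incH1LE S.T S.π S.e hy.killed hy.ker_red hπm hle 0 k (Nat.zero_le k)
          ((e0.symm x : ↥(((S.t 0).atLevel S.jbar n).cond).selmerGroup) : galoisCohomology (S.T.ρ 0) 1) =
        (x : galoisCohomology (S.T.ρ k) 1) := by
    intro x
    have h1 : ((e0 (e0.symm x) : ↥((((S.t k).atLevel S.jbar n).cond).selmerGroup ⊓ (galoisCohomology.scalarMapH1 (S.T.ρ k) (S.T.hlin k) S.π).ker)) :
        galoisCohomology (S.T.ρ k) 1) = (x : galoisCohomology (S.T.ρ k) 1) := by rw [AddEquiv.apply_symm_apply]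
    exact (hφ0 (e0.symm x)).symm.trans h1
  -- the transported pairing `P(x, w) = P₂(e_t⁻¹ x, e_0⁻¹ w)`
  let P : ↥((((S.t k).atLevel S.jbar n).cond).selmerGroup ⊓
        (galoisCohomology.scalarMapH1 (S.T.ρ k) (S.T.hlin k) (S.π ^ (t + 1))).ker) →+
      ↥((((S.t k).atLevel S.jbar n).cond).selmerGroup ⊓ (galoisCohomology.scalarMapH1 (S.T.ρ k) (S.T.hlin k) S.π).ker) →+ (R ⧸ IsLocalRing.maximalIdeal R) :=
    (P₂.comp et.symm.toAddMonoidHom).compl₂ e0.symm.toAddMonoidHom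
  have hP : ∀ x w, P x w = P₂ (et.symm x) (e0.symm w) := fun x w => by
    show ((P₂.comp et.symm.toAddMonoidHom).compl₂ e0.symm.toAddMonoidHom) x w = _
    rw [AddMonoidHom.compl₂_apply, AddMonoidHom.comp_apply]
    rfl
  refine ⟨P, ?_, ?_, ?_, ?_, ?_⟩
  · -- `R`-equivariance in the first slot
    intro r x x' w hx'
    rw [hP, hP]
    refine hP₁ r (et.symm x) (et.symm x') (e0.symm w) (hιt_inj ?_)
    rw [het_symm, hι_sm t htk', het_symm]
    exact hx'
  · -- `R`-equivariance in the second slot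
    intro r x w w' hw'
    rw [hP, hP]
    refine hP₂ r (et.symm x) (e0.symm w) (e0.symm w') (hι0_inj ?_)
    rw [he0_symm, hι_sm 0 (Nat.zero_le k), he0_symm]
    exact hw'
  · -- LEFT kernel `= π·𝓗_k(n)[π^{t+2}]`
    intro x
    have step1 : (∀ w, P x w = 0) ↔ ∀ w₀ : ↥(((S.t 0).atLevel S.jbar n).cond).selmerGroup, P₂ (et.symm x) w₀ = 0 := by
      constructor
      · intro h w₀
        have h2 := h (e0 w₀)
        rwa [hP, AddEquiv.symm_apply_apply] at h2
      · intro h w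
        rw [hP]
        exact h _
    rw [step1, hleft (et.symm x)]
    constructor
    · rintro ⟨z, hz, hzx⟩
      have hz' := (hAs _).2 ⟨z, hz, rfl⟩
      refine ⟨_, hz'.1, hz'.2, ?_⟩
      rw [← het_symm x, hzx, hred1]
    · rintro ⟨z', hz', hz'0, hxz'⟩
      obtain ⟨z, hz, rfl⟩ := (hAs z').1 ⟨hz', hz'0⟩
      refine ⟨z, hz, hιt_inj ?_⟩
      rw [het_symm, hxz', hred1]
  · -- RIGHT kernel `= π^{t+1}·𝓗_k(n)[π^{t+2}]`
    intro w
    have step1 : (∀ x, P x w = 0) ↔ ∀ a : ↥(((S.t t).atLevel S.jbar n).cond).selmerGroup, P₂ a (e0.symm w) = 0 := by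
      constructor
      · intro h a
        have h2 := h (et a)
        rwa [hP, AddEquiv.symm_apply_apply] at h2
      · intro h x
        rw [hP]
        exact h _
    rw [step1, hright (e0.symm w)]
    constructor
    · rintro ⟨z, hz, hzw⟩
      have hz' := (hAs _).2 ⟨z, hz, rfl⟩
      refine ⟨_, hz'.1, hz'.2, ?_⟩
      rw [← he0_symm w, hzw, hred2]
    · rintro ⟨z', hz', hz'0, hwz'⟩
      obtain ⟨z, hz, rfl⟩ := (hAs z').1 ⟨hz', hz'0⟩
      refine ⟨z, hz, hι0_inj ?_⟩
      rw [he0_symm, hwz', hred2]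
  · -- skew-symmetry «(a, π^{s-1}b)_{s,1} = -(b, π^{s-1}a)_{s,1}»
    intro a b a' b' ha' hb'
    rw [hP, hP]
    refine hskew (et.symm a) (et.symm b) (e0.symm a') (e0.symm b') (hι0_inj ?_) (hι0_inj ?_)
    · rw [he0_symm, hred3, het_symm]
      exact ha'
    · rw [he0_symm, hred3, het_symm]
      exact hb'

/-- **THM. 1.4.2-AS-APPLIED ON ONE FULL SETTING FROM ITS TOWER ENTRY** (the per-setting form the G87 engine consumes,
`thm161_printIntended_of_h159_hcheb` / `HasLevelDecompositionsAt`): on a FULL `DVRSetting` with H.0–H.5, two-module skew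
pairings `H¹_{𝓕(n)}(K, T^{(t)}) × H¹_{𝓕(n)}(K, T^{(0)}) → R/𝔪` with the kernels of Prop. 1.4.1 at `(s, t) = (t+1, 1)` and display (ii),
at every `(k, n ∈ 𝓝^{(k)}, t + 1 < e_k)`, give `S.HasLevelDecompositionsAt hy` — §2, then the tree's
`hasLevelDecompositionsAt_of_skewPairings_display` (alternation via `2 ∈ R^×`, even dimension, structure theorem).
[cite: Howard2004HeegnerKolyvagin, Prop. 1.4.1, Thm. 1.4.2 (with proof) and §1.6 ¶1 (arXiv:1202.6340 p0008 L83–L142, p0011 L33–44)]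
[cite: Flach1990, the generalised Cassels–Tate pairing and its kernels] -/
theorem hasLevelDecompositionsAt_of_towerSkewPairings (S : DVRSetting p K R N Rk Nbar Nq) (hy : S.SatisfiesH)
    (hfull : ∀ i, S.e i = i + 1)
    (h : ∀ (k : ℕ) (n : Finset (HeightOneSpectrum (𝓞 K))), ↑n ⊆ S.levelPrimes k → ∀ (t : ℕ), t + 1 < S.e k →
      ∃ P₂ : ↥(((S.t t).atLevel S.jbar n).cond).selmerGroup →+
          ↥(((S.t 0).atLevel S.jbar n).cond).selmerGroup →+ (R ⧸ IsLocalRing.maximalIdeal R),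
        (∀ (r : R) (a a' : ↥(((S.t t).atLevel S.jbar n).cond).selmerGroup)
            (w : ↥(((S.t 0).atLevel S.jbar n).cond).selmerGroup),
          (a' : galoisCohomology (S.T.ρ t) 1) =
            galoisCohomology.scalarMapH1 (S.T.ρ t) (S.T.hlin t) r (a : galoisCohomology (S.T.ρ t) 1) →
          P₂ a' w = r • P₂ a w) ∧
        (∀ (r : R) (a : ↥(((S.t t).atLevel S.jbar n).cond).selmerGroup)
            (w w' : ↥(((S.t 0).atLevel S.jbar n).cond).selmerGroup),
          (w' : galoisCohomology (S.T.ρ 0) 1) =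
            galoisCohomology.scalarMapH1 (S.T.ρ 0) (S.T.hlin 0) r (w : galoisCohomology (S.T.ρ 0) 1) →
          P₂ a w' = r • P₂ a w) ∧
        (∀ a : ↥(((S.t t).atLevel S.jbar n).cond).selmerGroup,
          (∀ w, P₂ a w = 0) ↔ ∃ z ∈ (((S.t (t + 1)).atLevel S.jbar n).cond).selmerGroup,
            (a : galoisCohomology (S.T.ρ t) 1) = S.redLEH1 (Nat.le_succ t) z) ∧
        (∀ w : ↥(((S.t 0).atLevel S.jbar n).cond).selmerGroup,
          (∀ a, P₂ a w = 0) ↔ ∃ z ∈ (((S.t (t + 1)).atLevel S.jbar n).cond).selmerGroup,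
            (w : galoisCohomology (S.T.ρ 0) 1) = S.redLEH1 (Nat.zero_le (t + 1)) z) ∧
        (∀ (a b : ↥(((S.t t).atLevel S.jbar n).cond).selmerGroup)
            (a₀ b₀ : ↥(((S.t 0).atLevel S.jbar n).cond).selmerGroup),
          (a₀ : galoisCohomology (S.T.ρ 0) 1) = S.redLEH1 (Nat.zero_le t) (a : galoisCohomology (S.T.ρ t) 1) →
          (b₀ : galoisCohomology (S.T.ρ 0) 1) = S.redLEH1 (Nat.zero_le t) (b : galoisCohomology (S.T.ρ t) 1) →
          P₂ a b₀ = - P₂ b a₀)) :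
    S.HasLevelDecompositionsAt hy := by
  refine S.hasLevelDecompositionsAt_of_skewPairings_display hy fun j n hn t ht => ?_
  obtain ⟨P₂, h₁, h₂, h₃, h₄, h₅⟩ := h j n hn t ht
  exact S.skewPairings_display_of_towerSkewPairing hy hfull j n hn t ht P₂ h₁ h₂ h₃ h₄ h₅

end DVRSetting

/-! ## §3 The leaf C45.1′ from two-module pairings on FULL towers -/

/-- **THE FLACH LEAF FROM ITS TOWER ENTRY.**  If on every FULL `DVRSetting` (`e_i = i + 1`: Howard's own tower
`T^{(j)} = T/𝔪^{j+1}T`, `T^{(0)} = T̄`) with H.0–H.5, for every level `k`, every `n ∈ 𝓝^{(k)}` and every `t + 1 < e_k`,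
there is a bi-additive `R`-equivariant pairing `P₂ : H¹_{𝓕(n)}(K, T^{(t)}) × H¹_{𝓕(n)}(K, T^{(0)}) → R/𝔪` with LEFT kernel
`H¹(red)(H¹_{𝓕(n)}(K, T^{(t+1)}))`, RIGHT kernel `H¹(red^{t+1})(H¹_{𝓕(n)}(K, T^{(t+1)}))` and
`P₂(a, H¹(red^t) b) = -P₂(b, H¹(red^t) a)` — Prop. 1.4.1 at `(s, t) = (t+1, 1)` in two-module form with display (ii), the
`T*`-side read on the `T`-side by H.4 — then the typed print leaf `prop141_casselsTate_skewPairing_atLevel` holds (for EVERY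
setting): §2, then `hasLevelDecompositionsAt_of_skewPairings_display` (x9-p1 LEAD g9) and
`prop141_casselsTate_skewPairing_atLevel_of_forall_full_hasLevelDecompositionsAt` (x10b-p1-w7 g11).  So a kernel
construction of Flach's pairing on the LEVELS of full towers closes the leaf BY NAME.  Nothing of it is constructed here.
[cite: Howard2004HeegnerKolyvagin, Prop. 1.4.1, Thm. 1.4.2 (with proof) and §1.6 ¶1 with Rem. 1.3.1 (arXiv:1202.6340 p0008 L83–L142, p0011 L33–44, p0007 L125–127)]
[cite: Flach1990, the generalised Cassels–Tate pairing and its kernels] -/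
theorem prop141_casselsTate_skewPairing_atLevel_of_forall_full_towerSkewPairings
    (h : ∀ (p : ℕ) [Fact p.Prime] (K : Type) [Field K] [NumberField K]
      (R : Type) [CommRing R] [IsDomain R] [IsDiscreteValuationRing R] [Algebra ℤ_[p] R]
      (N : ℕ → Type) [∀ k, AddCommGroup (N k)] [∀ k, TopologicalSpace (N k)]
      [∀ k, DiscreteTopology (N k)] [∀ k, Module R (N k)]
      (Rk : ℕ → Type) [∀ k, CommRing (Rk k)] [∀ k, IsLocalRing (Rk k)] [∀ k, TopologicalSpace (Rk k)]
      [∀ k, DiscreteTopology (Rk k)] [∀ k, Algebra ℤ_[p] (Rk k)] [∀ k, Algebra R (Rk k)]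
      [∀ k, Module (Rk k) (N k)] [∀ k, IsScalarTower R (Rk k) (N k)]
      (Nbar : Type) [AddCommGroup Nbar] [TopologicalSpace Nbar] [DiscreteTopology Nbar]
      [∀ k, Module (Rk k) Nbar]
      (Nq : ℕ → Finset (HeightOneSpectrum (𝓞 K)) → Type) [∀ k n, AddCommGroup (Nq k n)]
      [∀ k n, TopologicalSpace (Nq k n)] [∀ k n, DiscreteTopology (Nq k n)]
      [∀ k n, Module (Rk k) (Nq k n)] [∀ k n, Module R (Nq k n)]
      [∀ k n, IsScalarTower R (Rk k) (Nq k n)]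
      (S : DVRSetting p K R N Rk Nbar Nq) (hy : S.SatisfiesH), (∀ i, S.e i = i + 1) →
      ∀ (k : ℕ) (n : Finset (HeightOneSpectrum (𝓞 K))), ↑n ⊆ S.levelPrimes k → ∀ (t : ℕ), t + 1 < S.e k →
      ∃ P₂ : ↥(((S.t t).atLevel S.jbar n).cond).selmerGroup →+
          ↥(((S.t 0).atLevel S.jbar n).cond).selmerGroup →+ (R ⧸ IsLocalRing.maximalIdeal R),
        (∀ (r : R) (a a' : ↥(((S.t t).atLevel S.jbar n).cond).selmerGroup)
            (w : ↥(((S.t 0).atLevel S.jbar n).cond).selmerGroup),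
          (a' : galoisCohomology (S.T.ρ t) 1) =
            galoisCohomology.scalarMapH1 (S.T.ρ t) (S.T.hlin t) r (a : galoisCohomology (S.T.ρ t) 1) →
          P₂ a' w = r • P₂ a w) ∧
        (∀ (r : R) (a : ↥(((S.t t).atLevel S.jbar n).cond).selmerGroup)
            (w w' : ↥(((S.t 0).atLevel S.jbar n).cond).selmerGroup),
          (w' : galoisCohomology (S.T.ρ 0) 1) =
            galoisCohomology.scalarMapH1 (S.T.ρ 0) (S.T.hlin 0) r (w : galoisCohomology (S.T.ρ 0) 1) →
          P₂ a w' = r • P₂ a w) ∧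
        (∀ a : ↥(((S.t t).atLevel S.jbar n).cond).selmerGroup,
          (∀ w, P₂ a w = 0) ↔ ∃ z ∈ (((S.t (t + 1)).atLevel S.jbar n).cond).selmerGroup,
            (a : galoisCohomology (S.T.ρ t) 1) = S.redLEH1 (Nat.le_succ t) z) ∧
        (∀ w : ↥(((S.t 0).atLevel S.jbar n).cond).selmerGroup,
          (∀ a, P₂ a w = 0) ↔ ∃ z ∈ (((S.t (t + 1)).atLevel S.jbar n).cond).selmerGroup,
            (w : galoisCohomology (S.T.ρ 0) 1) = S.redLEH1 (Nat.zero_le (t + 1)) z) ∧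
        (∀ (a b : ↥(((S.t t).atLevel S.jbar n).cond).selmerGroup)
            (a₀ b₀ : ↥(((S.t 0).atLevel S.jbar n).cond).selmerGroup),
          (a₀ : galoisCohomology (S.T.ρ 0) 1) = S.redLEH1 (Nat.zero_le t) (a : galoisCohomology (S.T.ρ t) 1) →
          (b₀ : galoisCohomology (S.T.ρ 0) 1) = S.redLEH1 (Nat.zero_le t) (b : galoisCohomology (S.T.ρ t) 1) →
          P₂ a b₀ = - P₂ b a₀)) :
    prop141_casselsTate_skewPairing_atLevel := by
  refine prop141_casselsTate_skewPairing_atLevel_of_forall_full_hasLevelDecompositionsAt ?_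
  intro p _ K _ _ R _ _ _ _ N _ _ _ _ Rk _ _ _ _ _ _ _ _ Nbar _ _ _ _ Nq _ _ _ _ _ _ S hy hfull
  exact S.hasLevelDecompositionsAt_of_towerSkewPairings hy hfull (h p K R N Rk Nbar Nq S hy hfull)

end Literature.NumberTheory.GaloisCohomology.Howard2004

end
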